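import Mathlib
import Summits.Ventures.PercRepro2.Defs
import Summits.Ventures.PercRepro2.Independence
import Summits.Ventures.PercRepro2.Harris
import Summits.Ventures.PercRepro2.Graph
import Summits.Ventures.PercRepro2.Exploration
import Summits.Ventures.PercRepro2.Events
import Summits.Ventures.PercRepro2.FourFunctions
import Summits.Ventures.PercRepro2.Induced
import Summits.Ventures.PercRepro2.Frontier
import Summits.Ventures.PercRepro2.ObsIndependence
import Summits.Ventures.PercRepro2.BHK
import Summits.Ventures.PercRepro2.BHKEvents
import Summits.Ventures.PercRepro2.OrderPreservation
import Summits.Ventures.PercRepro2.BHKAvoid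
import Summits.Ventures.PercRepro2.SameClusterAvoid
import Summits.Ventures.PercRepro2.CaseOneRegime
import Summits.Ventures.PercRepro2.CaseOnePos
import Summits.Ventures.PercRepro2.CaseOneJ11
import Summits.Ventures.PercRepro2.CaseOneRV
import Summits.Ventures.PercRepro2.CaseOnePendant
import Summits.Ventures.PercRepro2.CaseOnePendantAny
import Summits.Ventures.PercRepro2.CaseOnePendantNec
import Summits.Ventures.PercRepro2.HullDefs
import Summits.Ventures.PercRepro2.OneEdge
import Summits.Ventures.PercRepro2.StarPattern
import Summits.Ventures.PercRepro2.HCov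
import Summits.Ventures.PercRepro2.HCovSwap
import Summits.Ventures.PercRepro2.OddsLemma
import Summits.Ventures.PercRepro2.RV
import Summits.Ventures.PercRepro2.RVBridge
import Summits.Ventures.PercRepro2.CaseOnePendantAnyI
import Summits.Ventures.PercRepro2.CaseOneDWorld

/-!
# The `(i)` side in the D-world: `(i)_D` as a Prop and `(i)_D ⟹ (i)` (blind cell PercRepro2, p1 g14;
S5 §2.1 (K9), P1-DWORLD.md §4 (2))

The mirror of `CaseOneDWorld.lean` for the `(i)` row of the Z-split: with `B₁ = {b ∈ C₁}` and
`D = Q ∩ {a₃ ∉ C₂}`,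

  `iExprD c₀ c₁ := −(P(D) E[1_{B₁} Z 1_D] − E[1_{B₁} 1_D] E[Z 1_D])`,  `Z = 1[a₃ ∈ C₁](c₁ 1[o ∈ C₂] − c₀)`,

**`ZSplitID`** := `0 ≤ iExprD D_o D`, and the exact tie (**`Dw_mul_iExprT_eq`**)

  `P(D) · iExprT c₀ c₁ = P(Q) · iExprD c₀ c₁ − (c₁ P(T′, o ∈ C₂) − c₀ P(T′)) · (P(Q, a₃ ∈ C₂) P(D, b ∈ C₁) − P(D) P(Q, a₃ ∈ C₂, b ∈ C₁))`

whose last factor is `≥ 0` by BHK 1.4 (`{b ∈ C₁}` against `{a₃ ∈ C₂}` under `Q`) and whose middle factor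
is `≤ 0` whenever `c₀/c₁ ≥ P(o ∈ C₂ ∣ T′)`: **`iExprT_nonneg_of_dworld`** and **`zSplitI_of_dworld`**.
Census (own code i_kit.py, kit j232632: n = 6, 5 ≤ m ≤ 10, 625,080 instances): `(i)_D` holds at the PD,
Q and D thresholds (0 failures; the case-1-world control fires) — unlike `(ii)_D` (NEG-127). Nothing
about `ZSplitID` itself is claimed. Own code; standard axioms.
-/

namespace Summit.Ventures.PercRepro2

namespace CaseOne

section Defs
variable {V : Type*} {E : Type*} [Fintype E] [DecidableEq E] {R : Type*} [CommRing R]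

/-- **The D-world `(i)` at a general threshold pair**, cleared by `P(D)²`:
`−(P(D) E[1_{b∈C₁} Z 1_D] − E[1_{b∈C₁} 1_D] E[Z 1_D])`, `Z = zFunT c₀ c₁`. -/
noncomputable def iExprD (p : E → R) (ends : E → Sym2 V) (o a₁ a₂ a₃ b : V) (c₀ c₁ : R) : R :=
  -(prob p (Dw ends a₁ a₂ a₃) *
      expect p (fun ω => (connEvent ends a₁ b).indicator 1 ω * zFunT ends o a₁ a₂ a₃ c₀ c₁ ω *
        (Dw ends a₁ a₂ a₃).indicator 1 ω) -
    expect p (fun ω => (connEvent ends a₁ b).indicator 1 ω * (Dw ends a₁ a₂ a₃).indicator 1 ω) *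
      expect p (fun ω => zFunT ends o a₁ a₂ a₃ c₀ c₁ ω * (Dw ends a₁ a₂ a₃).indicator 1 ω))

omit [Fintype E] [DecidableEq E] in
/-- `{b ∈ C₁} ∩ {a₃ ∈ C₁} ∩ {o ∈ C₂} ∩ D = … ∩ Q`. -/
lemma B₁AO_inter_Dw (ends : E → Sym2 V) (o a₁ a₂ a₃ b : V) :
    connEvent ends a₁ b ∩ connEvent ends a₁ a₃ ∩ connEvent ends a₂ o ∩ Dw ends a₁ a₂ a₃ =
      connEvent ends a₁ b ∩ connEvent ends a₁ a₃ ∩ connEvent ends a₂ o ∩ (connEvent ends a₁ a₂)ᶜ := by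
  ext ω
  simp only [Dw, Set.mem_inter_iff, Set.mem_compl_iff, mem_connEvent]
  exact ⟨fun h => ⟨h.1, h.2.1⟩, fun h => ⟨h.1, h.2, not_conn_a2_a3_of_A h.1.1.2 h.2⟩⟩

omit [Fintype E] [DecidableEq E] in
/-- `{b ∈ C₁} ∩ {a₃ ∈ C₁} ∩ D = … ∩ Q`. -/
lemma B₁A_inter_Dw (ends : E → Sym2 V) (a₁ a₂ a₃ b : V) :
    connEvent ends a₁ b ∩ connEvent ends a₁ a₃ ∩ Dw ends a₁ a₂ a₃ =
      connEvent ends a₁ b ∩ connEvent ends a₁ a₃ ∩ (connEvent ends a₁ a₂)ᶜ := by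
  ext ω
  simp only [Dw, Set.mem_inter_iff, Set.mem_compl_iff, mem_connEvent]
  exact ⟨fun h => ⟨h.1, h.2.1⟩, fun h => ⟨h.1, h.2, not_conn_a2_a3_of_A h.1.2 h.2⟩⟩

/-- **`iExprD` in event probabilities.** -/
theorem iExprD_eq (p : E → R) (ends : E → Sym2 V) (o a₁ a₂ a₃ b : V) (c₀ c₁ : R) :
    iExprD p ends o a₁ a₂ a₃ b c₀ c₁ =
      -(c₁ * (prob p (Dw ends a₁ a₂ a₃) *
          prob p (connEvent ends a₁ b ∩ connEvent ends a₁ a₃ ∩ connEvent ends a₂ o ∩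
            (connEvent ends a₁ a₂)ᶜ) -
        prob p (connEvent ends a₁ b ∩ Dw ends a₁ a₂ a₃) *
          prob p (connEvent ends a₁ a₃ ∩ connEvent ends a₂ o ∩ (connEvent ends a₁ a₂)ᶜ))) +
      c₀ * (prob p (Dw ends a₁ a₂ a₃) *
          prob p (connEvent ends a₁ b ∩ connEvent ends a₁ a₃ ∩ (connEvent ends a₁ a₂)ᶜ) -
        prob p (connEvent ends a₁ b ∩ Dw ends a₁ a₂ a₃) *
          prob p (connEvent ends a₁ a₃ ∩ (connEvent ends a₁ a₂)ᶜ)) := by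
  unfold iExprD zFunT
  have e1 : expect p (fun ω => (connEvent ends a₁ b).indicator (1 : Config E → R) ω *
      ((connEvent ends a₁ a₃).indicator 1 ω *
        (c₁ * (connEvent ends a₂ o).indicator 1 ω - c₀)) *
      (Dw ends a₁ a₂ a₃).indicator 1 ω) =
      expect p (fun ω => ((connEvent ends a₁ b).indicator (1 : Config E → R) ω *
        (connEvent ends a₁ a₃).indicator 1 ω) *
        (c₁ * (connEvent ends a₂ o).indicator 1 ω - c₀) *
        (Dw ends a₁ a₂ a₃).indicator 1 ω) := by
    congr 1
    funext ω
    ring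
  rw [e1, expect_mul_affine, expect_mul_affine]
  simp only [expect_ind4, expect_ind3, expect_ind2]
  rw [B₁AO_inter_Dw, AO_inter_Dw, B₁A_inter_Dw, A_inter_Dw]
  ring

/-- `P(Q, b ∈ C₁) = P(D, b ∈ C₁) + P(Q, a₃ ∈ C₂, b ∈ C₁)`. -/
lemma probQB₁_eq_DwB₁_add (p : E → R) (ends : E → Sym2 V) (a₁ a₂ a₃ b : V) :
    prob p (connEvent ends a₁ b ∩ (connEvent ends a₁ a₂)ᶜ) =
      prob p (connEvent ends a₁ b ∩ Dw ends a₁ a₂ a₃) +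
        prob p (connEvent ends a₁ b ∩ connEvent ends a₂ a₃ ∩ (connEvent ends a₁ a₂)ᶜ) := by
  have h := prob_inter_add_prob_inter_compl p (connEvent ends a₁ b ∩ (connEvent ends a₁ a₂)ᶜ)
    (connEvent ends a₂ a₃)
  have e1 : connEvent ends a₁ b ∩ (connEvent ends a₁ a₂)ᶜ ∩ (connEvent ends a₂ a₃)ᶜ =
      connEvent ends a₁ b ∩ Dw ends a₁ a₂ a₃ := by
    unfold Dw; rw [Set.inter_assoc]
  have e2 : connEvent ends a₁ b ∩ (connEvent ends a₁ a₂)ᶜ ∩ connEvent ends a₂ a₃ =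
      connEvent ends a₁ b ∩ connEvent ends a₂ a₃ ∩ (connEvent ends a₁ a₂)ᶜ := by
    ext ω; simp only [Set.mem_inter_iff]; tauto
  rw [e1, e2] at h
  linear_combination -h

/-- **The Q-world and the D-world `(i)` are tied by an exact identity**:
`P(D) · iExprT c₀ c₁ = P(Q) · iExprD c₀ c₁ − (c₁ P(T′, o ∈ C₂) − c₀ P(T′)) · (P(Q, a₃ ∈ C₂) P(D, b ∈ C₁) − P(D) P(Q, a₃ ∈ C₂, b ∈ C₁))`. -/
theorem Dw_mul_iExprT_eq (p : E → R) (ends : E → Sym2 V) (o a₁ a₂ a₃ b : V) (c₀ c₁ : R) :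
    prob p (Dw ends a₁ a₂ a₃) * iExprT p ends o a₁ a₂ a₃ b c₀ c₁ =
      prob p (connEvent ends a₁ a₂)ᶜ * iExprD p ends o a₁ a₂ a₃ b c₀ c₁ -
        (c₁ * prob p (connEvent ends a₁ a₃ ∩ connEvent ends a₂ o ∩ (connEvent ends a₁ a₂)ᶜ) -
          c₀ * prob p (connEvent ends a₁ a₃ ∩ (connEvent ends a₁ a₂)ᶜ)) *
        (prob p (connEvent ends a₂ a₃ ∩ (connEvent ends a₁ a₂)ᶜ) *
            prob p (connEvent ends a₁ b ∩ Dw ends a₁ a₂ a₃) -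
          prob p (Dw ends a₁ a₂ a₃) *
            prob p (connEvent ends a₁ b ∩ connEvent ends a₂ a₃ ∩ (connEvent ends a₁ a₂)ᶜ)) := by
  rw [iExprT_eq, iExprD_eq, probQ_eq_Dw_add p ends a₁ a₂ a₃, probQB₁_eq_DwB₁_add p ends a₁ a₂ a₃ b]
  ring

end Defs

section Prop'
variable {V : Type*} {E : Type*} [Fintype E] [DecidableEq E] {R : Type*} [CommRing R] [LinearOrder R]

/-- **The D-world `(i)` at the PD pair**: `0 ≤ iExprD D_o D`. A definition only. -/
def ZSplitID (p : E → R) (ends : E → Sym2 V) (o a₁ a₂ a₃ b : V) : Prop :=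
  0 ≤ iExprD p ends o a₁ a₂ a₃ b (Dpdo p ends o a₁ a₂ a₃) (Dpd p ends a₁ a₂ a₃)

end Prop'

section Order
variable {V : Type*} {E : Type*} [Fintype E] [DecidableEq E] [Fintype V] [DecidableEq V]
  {R : Type*} [CommRing R] [LinearOrder R] [IsStrictOrderedRing R]

/-- BHK 1.4 under `Q` for `{b ∈ C₁}` against `{a₃ ∈ C₂}`:
`P(Q, b ∈ C₁, a₃ ∈ C₂) · P(Q) ≤ P(Q, b ∈ C₁) · P(Q, a₃ ∈ C₂)`. -/
lemma bhk_cross_b1_a3 (p : E → R) (hp : IsProbVec p) (ends : E → Sym2 V) (a₁ a₂ a₃ b : V) :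
    prob p (connEvent ends a₁ b ∩ connEvent ends a₂ a₃ ∩ (connEvent ends a₁ a₂)ᶜ) *
        prob p (connEvent ends a₁ a₂)ᶜ ≤
      prob p (connEvent ends a₁ b ∩ (connEvent ends a₁ a₂)ᶜ) *
        prob p (connEvent ends a₂ a₃ ∩ (connEvent ends a₁ a₂)ᶜ) := by
  have h := bhk_cross_cluster p hp ends a₁ a₂ (isUpperSet_mem_setOf b) (isUpperSet_mem_setOf a₃)
  rw [← connEvent_eq_clusterInEvent ends a₁ b, ← connEvent_eq_clusterInEvent ends a₂ a₃] at h
  exact h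

/-- **`(i-t)_D ⟹ (i-t)`** for every pair with `c₁ · P(T′, o ∈ C₂) ≤ c₀ · P(T′)`. -/
theorem iExprT_nonneg_of_dworld (p : E → R) (hp : IsProbVec p) (ends : E → Sym2 V)
    (o a₁ a₂ a₃ b : V) (c₀ c₁ : R)
    (hD : 0 ≤ iExprD p ends o a₁ a₂ a₃ b c₀ c₁)
    (hodds : c₁ * prob p (connEvent ends a₁ a₃ ∩ connEvent ends a₂ o ∩ (connEvent ends a₁ a₂)ᶜ) ≤
      c₀ * prob p (connEvent ends a₁ a₃ ∩ (connEvent ends a₁ a₂)ᶜ)) :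
    0 ≤ iExprT p ends o a₁ a₂ a₃ b c₀ c₁ := by
  have hkey := Dw_mul_iExprT_eq p ends o a₁ a₂ a₃ b c₀ c₁
  have hbhk := bhk_cross_b1_a3 p hp ends a₁ a₂ a₃ b
  have hq := probQ_eq_Dw_add p ends a₁ a₂ a₃
  have hqB := probQB₁_eq_DwB₁_add p ends a₁ a₂ a₃ b
  have hlast : 0 ≤ prob p (connEvent ends a₂ a₃ ∩ (connEvent ends a₁ a₂)ᶜ) *
      prob p (connEvent ends a₁ b ∩ Dw ends a₁ a₂ a₃) -
      prob p (Dw ends a₁ a₂ a₃) *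
        prob p (connEvent ends a₁ b ∩ connEvent ends a₂ a₃ ∩ (connEvent ends a₁ a₂)ᶜ) := by
    rw [hq, hqB] at hbhk
    nlinarith [hbhk]
  have hmid : c₁ * prob p (connEvent ends a₁ a₃ ∩ connEvent ends a₂ o ∩ (connEvent ends a₁ a₂)ᶜ) -
      c₀ * prob p (connEvent ends a₁ a₃ ∩ (connEvent ends a₁ a₂)ᶜ) ≤ 0 := by linarith
  have hprod := mul_nonpos_of_nonpos_of_nonneg hmid hlast
  have hQ0 : 0 ≤ prob p (connEvent ends a₁ a₂)ᶜ := prob_nonneg hp _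
  have hmul : 0 ≤ prob p (Dw ends a₁ a₂ a₃) * iExprT p ends o a₁ a₂ a₃ b c₀ c₁ := by
    rw [hkey]
    have := mul_nonneg hQ0 hD
    linarith
  rcases (prob_nonneg hp (Dw ends a₁ a₂ a₃)).lt_or_eq with hd | hd
  · exact nonneg_of_mul_nonneg_right (by linarith [hmul]) hd
  · rw [iExprT_eq]
    have h1 := prob_A_eq_zero_of_Dw p hp ends a₁ a₂ a₃ hd.symm (X := connEvent ends a₁ b ∩
      connEvent ends a₁ a₃ ∩ connEvent ends a₂ o ∩ (connEvent ends a₁ a₂)ᶜ)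
      (fun ω h => ⟨h.1.1.2, h.2⟩)
    have h2 := prob_A_eq_zero_of_Dw p hp ends a₁ a₂ a₃ hd.symm (X := connEvent ends a₁ a₃ ∩
      connEvent ends a₂ o ∩ (connEvent ends a₁ a₂)ᶜ) (fun ω h => ⟨h.1.1, h.2⟩)
    have h3 := prob_A_eq_zero_of_Dw p hp ends a₁ a₂ a₃ hd.symm (X := connEvent ends a₁ b ∩
      connEvent ends a₁ a₃ ∩ (connEvent ends a₁ a₂)ᶜ) (fun ω h => ⟨h.1.2, h.2⟩)
    have h4 := prob_A_eq_zero_of_Dw p hp ends a₁ a₂ a₃ hd.symm (X := connEvent ends a₁ a₃ ∩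
      (connEvent ends a₁ a₂)ᶜ) (fun ω h => h)
    rw [h1, h2, h3, h4]
    simp

end Order

section PD
variable {V : Type*} {E : Type*} [Fintype E] [DecidableEq E] [Fintype V] [DecidableEq V]
  {R : Type*} [Field R] [LinearOrder R] [IsStrictOrderedRing R]

/-- **`ZSplitID ⟹ ZSplitI`**: the D-world `(i)` at the PD pair implies `(i)`. -/
theorem zSplitI_of_dworld (p : E → R) (hp : IsProbVec p) (ends : E → Sym2 V) (o a₁ a₂ a₃ b : V)
    (h : ZSplitID p ends o a₁ a₂ a₃ b) : ZSplitI p ends o a₁ a₂ a₃ b := by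
  unfold ZSplitID at h
  unfold ZSplitI
  rw [iExpr_eq_iExprT]
  exact iExprT_nonneg_of_dworld p hp ends o a₁ a₂ a₃ b _ _ h (odds_pd p hp ends o a₁ a₂ a₃)

/-- **`(J1₁)` from the two D-world rows**: `ZSplitID ∧ ZSplitIID ⟹ JOneOne`. -/
theorem jOneOne_of_dworld (p : E → R) (hp : IsProbVec p) (ends : E → Sym2 V) (o a₁ a₂ a₃ b : V)
    (hI : ZSplitID p ends o a₁ a₂ a₃ b) (hII : ZSplitIID p ends o a₁ a₂ a₃ b) :
    JOneOne p ends o a₁ a₂ a₃ b :=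
  jOneOne_of_i_of_ii p ends o a₁ a₂ a₃ b (zSplitI_of_dworld p hp ends o a₁ a₂ a₃ b hI)
    (zSplitII_of_dworld p hp ends o a₁ a₂ a₃ b hII)

end PD

end CaseOne

end Summit.Ventures.PercRepro2
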